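import Literature.MathematicalPhysics.QuantumFieldTheory.Balaban1983to89.B7Eq136Expansion

/-!
# `Balaban1983to89.B7Eq136ThirdOrder` — T. Bałaban, *Averaging operations for lattice gauge theories*, Commun. Math. Phys. **98** (1985)
17–51 [Balaban1985Averaging], (136) p. 39: **THE THIRD-ORDER TERM `C_j⁽³⁾(U₀, ·)` OF «C_k(U₀, A) = C_k^{(2)}(U₀, A) + C_k^{(3)}(U₀, A) + …»
ON THE CONCRETE `ℤᵈ` CARRIER** — the `t³`-coefficient of the complex slice `t ↦ C_j(U₀, tB)(c)`, its Cauchy bound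
`‖C_j⁽³⁾(U₀, B)(c)‖ ≤ C₂(Lʲ)²b⁻¹‖B‖³_∞`, and the QUARTIC remainder `‖C_j − C_j⁽²⁾ − C_j⁽³⁾‖ ≤ 3C₂(Lʲ)²b⁻²‖B‖⁴_∞` — the inputs «C3, c₃, K₄» that
[B11] (56) at ORDER THREE («D^{(3)}(A′) = C^{(3)}(LʲηA′) − 2C^{(2)}(LʲηA′, LʲηHC^{(2)}(A′))») takes from [B7]

statement-level skeleton of published theorems with citation tags; proofs where landed; nothing here is a claim about the Yang–Mills mass gap

PDF held: `paper:balaban1985-cmp98-averaging` (journal page = PDF page + 16), renders `…/1985-cmp98-averaging-p022-x2.png`, `-p023-x2.png`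
(pp. 38–39) read as images (cell `b2b-balaban-ref1` page renders); `paper:balaban1985-cmp102-variational-background` p. 286 [PDF 10] (text layer
`p0010.txt`).

CITATION HEADER / WHAT IS REPRODUCED.  Cell `lit-balaban` (HOME `run/shared/lean/pub/lit-balaban/`), Phase-2 proof seat p06 gen 6 = unit
`lit-balaban-p06` (TAKING line HOME/STATUS.md 2026-08-21T11:01:20Z; file 1 of the `C_j⁽³⁾` lane, sequel of the gen-5 `C_j⁽²⁾` files
`B7Eq136SecondOrder` / `B7Eq136Expansion`); SKELETON rows **B7.Prop4 / B7.Eq127** (display (136); owner r04) and **B11.Eq55** ((56) at order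
three; owner r08: the HYPOTHESES `C3`, `c₃`, `K₄`/`h4` «‖C(Y) − C2 Y Y − C3 Y Y Y‖ ≤ K₄‖Y‖⁴ … what the Cauchy estimates give for an analytic
C = Σ_{n≥2} C^{(n)}; HYPOTHESES here» of `B11Eq56Expansion.eq56_order3(_fixedPoint)`).  THE PRINT.  [B7] p. 38: *«Q_k(U₀, ηA) = Q_k(U₀)A +
C_k(U₀, A), (134) and |C_k(U₀, A)| ≦ C₂|A|² < C₂α₁². (135)»*; p. 39: *«The function C_k can be decomposed further into a sum of homogeneous
polynomials, C_k(U₀, A) = C_k^{(2)}(U₀, A) + C_k^{(3)}(U₀, A) + … . (136)»*; (137) *«dF(A, δA) = (d/dt)F(A + tδA)|_{t=0}»*.  [B11] p. 286 (56):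
*«C_j(LʲηA′ − LʲηHD(A′)) = Σ_{n=2}^∞ C_j^{(n)}(LʲηA′ − LʲηH Σ_{m=2}^∞ D^{(m)}(A′)) = Σ_{n=2}^∞ D^{(n)}(A′), (56) where C_j^{(n)}, D^{(n)} are
homogeneous polynomials of n-th order. From Eq. (56) a sequence of recursive equations for D^{(n)} follows. It can be solved easily. For example we
have on Λ_j D^{(2)}(A′) = C^{(2)}(LʲηA′), D^{(3)}(A′) = C^{(3)}(LʲηA′) − 2C^{(2)}(LʲηA′, LʲηHC^{(2)}(A′)), and so on.»*  The quantitative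
statements below (the size of `C^{(3)}` alone; the quartic remainder with its constant) are printed nowhere; they are what the Cauchy estimate
along slices gives for the analytic `C_j(U₀, ·)` of Prop. 4 bounded by (135) (cell GAPS G-adv2-29 (ii) zone, r08's `B11SchwarzRemainder`).

DICTIONARY.  As `B7Eq136SecondOrder` / `B7Eq136Expansion`: `C_j(U₀, B)(c)` ↦ `CCovIter L U₀ B j z κ` (`c = (z, κ)`), `C_j⁽²⁾(U₀, B)(c)` ↦
`CCovIter2 L U₀ B j z κ := ½·(d²/dt²)C_j(U₀, tB)(c)|₀`; THIS FILE: **`C_j⁽³⁾(U₀, B)(c)` ↦ `CCovIter3 L U₀ B j z κ := (3!)⁻¹·(d³/dt³)C_j(U₀,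
tB)(c)|_{t=0}`** (`t ∈ ℂ`; the `t³`-coefficient of the slice, (137)); `B` is ANY bond field on `ℤᵈ` with `‖B_b‖ ≤ β` (everything is read on the
slice `t ↦ tB`); print's `C₂` of (135) ↦ `B7Eq123General.prop4_general` (i)'s `8·C₁·e^{4cα₀}`, `C₁ = 131072(d+1)²`, `c = 800(d+1)²(d+4)` (local
notation `C₂`); `|A|` ↦ `Lʲβ`.  Regime = Prop. 4's at a general background exactly as in `B7Eq136Expansion` (`L ≥ 2`, `AvgClosed` structure
group, (52) `pdev U₀ < α₀L^{−2k}`, `C₀α₀ ≤ ⅓`, `4α₀ ≤ c₂′`, witness radius `b > 0` with `hsmall`, `2Lᵏb ≤ c₃`); the slice through `B` lives on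
the CLOSED disc `|t| ≤ b/β`.

WHAT THIS FILE PROVES (one definition with body + theorems; kernel, 0 sorry, standard axioms), for `j ≤ k`, `0 < β`, `‖B_b‖ ≤ β`:
* §0 (generic, private, [folklore]) `leadCoeff_eq_inv_factorial_smul_iteratedDeriv`: r08's divided-slope coefficient `leadCoeff φ n` IS the Taylor
  coefficient `(n!)⁻¹·φ⁽ⁿ⁾(0)` for `φ` analytic at `0` (general `n`; the `n = 2` case was private in `B7Eq136Expansion`); the cubic monomial has
  no third Taylor coefficient other than from `φ`: `iteratedDeriv 3 (t ↦ φ t − t²•a) 0 = iteratedDeriv 3 φ 0`.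
* §1 `CCovIter3` (definition above), `CCovIter3_def`, `CCovIter3_zero_field`.
* §2 `norm_CCovIter_slice_le_closed` ((135) along the slice on the CLOSED disc `|t|β ≤ b`), `diffContOnCl_CCovIter_slice`,
  **`norm_iteratedDeriv_three_CCovIter_slice_le`** (Cauchy: `‖(d³/dt³)C_j(U₀, tB)(c)|₀‖ ≤ 3!·C₂(Lʲ)²b⁻¹β³`), **`norm_CCovIter3_le`**
  (`‖C_j⁽³⁾(U₀, B)(c)‖ ≤ C₂(Lʲ)²b⁻¹β³` — the `c₃`-type size of the third-order term), **`CCovIter3_eq_leadCoeff`** (`C_j⁽³⁾(U₀, B)(c) =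
  leadCoeff (t ↦ C_j(U₀, tB)(c) − t²C_j⁽²⁾(U₀, B)(c)) 3` — the third-order term IS r08's next divided-slope coefficient after the second),
  **`tendsto_CCovIter3`** (`t⁻³(C_j(U₀, tB)(c) − t²C_j⁽²⁾(U₀, B)(c)) → C_j⁽³⁾(U₀, B)(c)`, `t → 0`: «C_k^{(3)}» is the next homogeneous term),
  **`norm_CCovIter_sub_two_three_slice_le`** (`‖C_j(U₀, tB)(c) − t²C⁽²⁾ − t³C⁽³⁾‖ ≤ 3C₂(Lʲ)²β⁴b⁻²·|t|⁴` on `|t| < b/β`) and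
  **`norm_CCovIter_sub_two_three_le`** (for `β < b`: `‖C_j(U₀, B)(c) − C_j⁽²⁾(U₀, B)(c) − C_j⁽³⁾(U₀, B)(c)‖ ≤ 3C₂(Lʲ)²b⁻²β⁴` — (136) beyond THIRD
  order is QUARTIC, `K₄ = 3C₂(Lʲ)²/b²`).
NOT CLAIMED: the individual terms `C^{(n)}`, `n ≥ 4`, and the convergence of (136) (r04 `B7Prop4GeneralCk.prop4_general_Ck_powerSeries`); the
polarization of `C⁽³⁾` and (149)-type bounds for it (sequel `B7Eq136ThirdPolarization`); optimality of constants.  NOT summit progress.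
-/

noncomputable section

open scoped BigOperators Topology
open NormedSpace Finset Metric Filter

namespace Literature.MathematicalPhysics.QuantumFieldTheory.Balaban1983to89.B7Eq136ThirdOrder

open B7Prop1Explicit B7Prop1Local B7Prop2Explicit B7Prop3Flat B7Prop4Flat B7Eq92Concrete B7Prop3GeneralLinear
  B7Prop4GeneralLevels B7Prop5GeneralInduction B7Prop5GeneralLevels B7Eq136SecondOrder B7Eq136Expansion
open B7Prop6GeneralAnalytic (prop4_general_analyticAt)
open B7Prop4GeneralCk (linCovIter_csmul)
open B11SchwarzRemainder (tail leadCoeff tendsto_leadCoeff norm_leadCoeff_le_of_pow_bound norm_sub_leadCoeff_le_of_pow_bound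
  norm_sub_leadCoeff_le_of_pow_bound_two OrderGe)

-- `Site` alone would resolve to the torus sites of `Setup.lean`; re-export the `ℤ^d` sites of `B7Prop1Explicit`.
export B7Prop1Explicit (Site)

variable {d : ℕ}

/-! ## §0 Divided-slope coefficients are Taylor coefficients (generic) -/

section Coeff

variable {F : Type*} [NormedAddCommGroup F] [NormedSpace ℂ F] [CompleteSpace F]

/-- For `φ : ℂ → F` analytic at `0`, r08's `leadCoeff φ n` (the value at `0` of the `n`-times-iterated divided slope,
`B11SchwarzRemainder.leadCoeff`) is the Taylor coefficient `(n!)⁻¹·φ⁽ⁿ⁾(0)` (Mathlib `has_fpower_series_iterate_dslope_fslope`,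
`coeff_iterate_fslope`, `HasFPowerSeriesOnBall.factorial_smul`). [folklore] -/
private theorem leadCoeff_eq_inv_factorial_smul_iteratedDeriv {φ : ℂ → F} (hφ : AnalyticAt ℂ φ 0) (n : ℕ) :
    leadCoeff φ n = ((Nat.factorial n : ℕ) : ℂ)⁻¹ • iteratedDeriv n φ 0 := by
  obtain ⟨q, r, hr⟩ := hφ
  have hq : HasFPowerSeriesAt φ q 0 := ⟨r, hr⟩
  -- `leadCoeff φ n = q.coeff n`
  have h1 : HasFPowerSeriesAt (tail φ n) (FormalMultilinearSeries.fslope^[n] q) 0 :=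
    hq.has_fpower_series_iterate_dslope_fslope n
  have h2 : leadCoeff φ n = q.coeff n := by
    have h : (FormalMultilinearSeries.fslope^[n] q).coeff 0 = tail φ n 0 := h1.coeff_zero 1
    rw [FormalMultilinearSeries.coeff_iterate_fslope, zero_add] at h
    exact h.symm
  -- `n! • q.coeff n = φ⁽ⁿ⁾(0)`
  have h3 : ((Nat.factorial n : ℕ) : ℂ) • q.coeff n = iteratedDeriv n φ 0 := by
    rw [Nat.cast_smul_eq_nsmul, iteratedDeriv_eq_iteratedFDeriv]
    exact hr.factorial_smul 1 n
  rw [h2, ← h3, smul_smul, inv_mul_cancel₀ (Nat.cast_ne_zero.mpr (Nat.factorial_ne_zero n)), one_smul]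

omit [CompleteSpace F] in
/-- the quadratic monomial contributes nothing to the third Taylor coefficient: for `φ` three times continuously differentiable at `0`,
`(d³/dt³)(φ(t) − t²•a)|₀ = φ‴(0)`. [folklore] -/
private theorem iteratedDeriv_three_sub_sq_smul {φ : ℂ → F} (hφ : ContDiffAt ℂ 3 φ 0) (a : F) :
    iteratedDeriv 3 (fun t : ℂ => φ t - t ^ 2 • a) 0 = iteratedDeriv 3 φ 0 := by
  have hm : ContDiffAt ℂ 3 (fun t : ℂ => t ^ 2 • a) 0 := ((contDiff_id.pow 2).smul contDiff_const).contDiffAt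
  have hsub : iteratedDeriv 3 (fun t : ℂ => φ t - t ^ 2 • a) 0 =
      iteratedDeriv 3 φ 0 - iteratedDeriv 3 (fun t : ℂ => t ^ 2 • a) 0 := iteratedDeriv_fun_sub hφ hm
  have hmono : iteratedDeriv 3 (fun t : ℂ => t ^ 2 • a) 0 = 0 := by
    have hp : ContDiffAt ℂ 3 (fun t : ℂ => t ^ 2) 0 := (contDiff_id.pow 2).contDiffAt
    rw [iteratedDeriv_smul_const hp, iteratedDeriv_fun_pow_zero]
    norm_num
  rw [hsub, hmono, sub_zero]

end Coeff

/-! ## §1 The third-order term `C_j⁽³⁾(U₀, B)(c)` -/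

section Def

variable {𝔸 : Type*} [NormedRing 𝔸] [NormedAlgebra ℂ 𝔸] [CompleteSpace 𝔸]

/-- **`C_j⁽³⁾(U₀, B)(c)`, THE THIRD-ORDER TERM of the remainder `C_j(U₀, ·)(c)`** — [B7] (136) «C_k(U₀, A) = C_k^{(2)}(U₀, A) +
C_k^{(3)}(U₀, A) + …» (homogeneous polynomials), [B11] (56) «C^{(3)}(LʲηA′)»: the `t³`-coefficient `(3!)⁻¹·(d³/dt³)C_j(U₀, t·B)(c)|_{t=0}`
of the complex slice `t ↦ C_j(U₀, tB)(c)` ([B7] (137)), the companion of `B7Eq136SecondOrder.CCovIter2`.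
[cite: Balaban1985Averaging, (136) p.39, (137) p.39] [cite: Balaban1985Variational, (56) p.286] -/
def CCovIter3 (L : ℕ) (U₀ : Site d → Fin d → 𝔸ˣ) (B : Site d → Fin d → 𝔸) (j : ℕ) (z : Site d) (κ : Fin d) : 𝔸 :=
  ((Nat.factorial 3 : ℕ) : ℂ)⁻¹ • iteratedDeriv 3 (fun t : ℂ => CCovIter L U₀ (t • B) j z κ) 0

/-- `CCovIter3` unfolded. [cite: Balaban1985Averaging, (136) p.39] -/
theorem CCovIter3_def (L : ℕ) (U₀ : Site d → Fin d → 𝔸ˣ) (B : Site d → Fin d → 𝔸) (j : ℕ) (z : Site d) (κ : Fin d) :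
    CCovIter3 L U₀ B j z κ = ((Nat.factorial 3 : ℕ) : ℂ)⁻¹ • iteratedDeriv 3 (fun t : ℂ => CCovIter L U₀ (t • B) j z κ) 0 := rfl

/-- `C_j⁽³⁾(U₀, 0) = 0` (the slice through `0` is constant). [cite: Balaban1985Averaging, (136) p.39] -/
theorem CCovIter3_zero_field (L : ℕ) (U₀ : Site d → Fin d → 𝔸ˣ) (j : ℕ) (z : Site d) (κ : Fin d) :
    CCovIter3 L U₀ (0 : Site d → Fin d → 𝔸) j z κ = 0 := by
  simp [CCovIter3, smul_zero, iteratedDeriv_const]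

end Def

/-! ## §2 Along the slice `t ↦ C_j(U₀, tB)(c)`: Cauchy bound, coefficient identification, quartic remainder -/

section Regime

variable {𝔸 : Type*} [NormedRing 𝔸] [NormedAlgebra ℂ 𝔸] [CompleteSpace 𝔸] [NormOneClass 𝔸]

/-- the smallness hypotheses of Prop. 4 are monotone in the radius (private arithmetic, as in `B7Eq136Expansion`). [folklore] -/
private theorem smallness_mono {L k d : ℕ} {α₀ b b' : ℝ} (hbb : b' ≤ b)
    (hsmall : Real.exp (4 * (800 * ((d : ℝ) + 1) ^ 2 * ((d : ℝ) + 4)) * α₀)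
      * (1 + 8 * (131072 * ((d : ℝ) + 1) ^ 2) * ((L : ℝ) ^ k * b)) ≤ 2)
    (hc₃ : 2 * ((L : ℝ) ^ k * b) ≤ c3 d L) :
    Real.exp (4 * (800 * ((d : ℝ) + 1) ^ 2 * ((d : ℝ) + 4)) * α₀)
        * (1 + 8 * (131072 * ((d : ℝ) + 1) ^ 2) * ((L : ℝ) ^ k * b')) ≤ 2 ∧
      2 * ((L : ℝ) ^ k * b') ≤ c3 d L := by
  have hLk : (0 : ℝ) ≤ (L : ℝ) ^ k := by positivity
  have hm : (L : ℝ) ^ k * b' ≤ (L : ℝ) ^ k * b := mul_le_mul_of_nonneg_left hbb hLk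
  refine ⟨?_, by linarith⟩
  have hexp : 0 ≤ Real.exp (4 * (800 * ((d : ℝ) + 1) ^ 2 * ((d : ℝ) + 4)) * α₀) := (Real.exp_pos _).le
  have h1 : 1 + 8 * (131072 * ((d : ℝ) + 1) ^ 2) * ((L : ℝ) ^ k * b')
      ≤ 1 + 8 * (131072 * ((d : ℝ) + 1) ^ 2) * ((L : ℝ) ^ k * b) := by
    have : 0 ≤ 8 * (131072 * ((d : ℝ) + 1) ^ 2) := by positivity
    nlinarith
  exact (mul_le_mul_of_nonneg_left h1 hexp).trans hsmall

variable (L : ℕ) (hL : 2 ≤ L) {G : Subgroup 𝔸ˣ} (hG : AvgClosed d L G) (k : ℕ)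
  (U₀ : Site d → Fin d → 𝔸ˣ) (hU₀ : ∀ x κ, U₀ x κ ∈ G) {α₀ : ℝ} (hα : 0 < α₀)
  (hα3 : C0 d * α₀ ≤ 1 / 3) (hα4 : 4 * α₀ ≤ c2' d L) (h52 : pdev U₀ < α₀ * (((L : ℝ) ^ k)⁻¹) ^ 2)
  {b : ℝ} (hb : 0 < b)
  (hsmall : Real.exp (4 * (800 * ((d : ℝ) + 1) ^ 2 * ((d : ℝ) + 4)) * α₀)
    * (1 + 8 * (131072 * ((d : ℝ) + 1) ^ 2) * ((L : ℝ) ^ k * b)) ≤ 2)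
  (hc₃ : 2 * ((L : ℝ) ^ k * b) ≤ c3 d L)
  {B : Site d → Fin d → 𝔸} {β : ℝ} (hβ : 0 < β) (hB : ∀ x κ, ‖B x κ‖ ≤ β)

/-- print's `C₂` of (135) at a general background (`B7Eq123General.prop4_general` (i)): `8·C₁·e^{4cα₀}`. -/
local notation "C₂" => (8 * (131072 * ((d : ℝ) + 1) ^ 2) * Real.exp (4 * (800 * ((d : ℝ) + 1) ^ 2 * ((d : ℝ) + 4)) * α₀))

omit [CompleteSpace 𝔸] [NormOneClass 𝔸] in
include hB in
/-- the entries of `tB` are bounded by `|t|β`. [folklore] -/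
private theorem norm_smul_entry_le (t : ℂ) (x : Site d) (κ : Fin d) : ‖(t • B) x κ‖ ≤ ‖t‖ * β := by
  rw [Pi.smul_apply, Pi.smul_apply, norm_smul]
  exact mul_le_mul_of_nonneg_left (hB x κ) (norm_nonneg t)

include hL hG hU₀ hα hα3 hα4 h52 hsmall hc₃ hβ hB in
/-- **(135) ALONG THE SLICE, ON THE CLOSED DISC**: `‖C_j(U₀, tB)(c)‖ ≤ C₂·(Lʲβ)²·|t|²` whenever `|t|β ≤ b` (`B7Eq123General.prop4_general`
(i) at the field `tB` of size `|t|β`; the closed-disc version of `B7Eq136Expansion.norm_CCovIter_slice_le`, needed on the Cauchy circle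
`|t| = b/β`). [cite: Balaban1985Averaging, (135) p.38, (130) p.38] -/
theorem norm_CCovIter_slice_le_closed {j : ℕ} (hj : j ≤ k) (z : Site d) (κ : Fin d) {t : ℂ} (ht : ‖t‖ * β ≤ b) :
    ‖CCovIter L U₀ (t • B) j z κ‖ ≤ C₂ * ((L : ℝ) ^ j * β) ^ 2 * ‖t‖ ^ 2 := by
  obtain ⟨hs, hc⟩ := smallness_mono (L := L) (k := k) (d := d) (α₀ := α₀) ht hsmall hc₃
  have h := (B7Eq123General.prop4_general L hL hG k U₀ hU₀ hα hα3 hα4 h52 (t • B) (by positivity)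
    (fun x κ' => norm_smul_entry_le hB t x κ') hs hc j hj).1 z κ
  refine h.trans (le_of_eq ?_)
  ring

include hL hG hU₀ hα hα3 hα4 h52 hb hsmall hc₃ hβ hB in
/-- the slice is complex-differentiable on the open disc `|t| < b/β` and continuous on its closure (it is analytic at every point of the
CLOSED disc, `B7Eq136Expansion.analyticAt_CCovIter_slice`) — the hypothesis of Cauchy's estimate. [cite: Balaban1985Averaging, Prop. 4 p.38] -/
theorem diffContOnCl_CCovIter_slice {j : ℕ} (hj : j ≤ k) (z : Site d) (κ : Fin d) :
    DiffContOnCl ℂ (fun t : ℂ => CCovIter L U₀ (t • B) j z κ) (ball (0 : ℂ) (b / β)) := by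
  refine DifferentiableOn.diffContOnCl fun t ht => ?_
  rw [closure_ball (0 : ℂ) (div_pos hb hβ).ne', mem_closedBall_zero_iff] at ht
  have ht' : ‖t‖ * β ≤ b := (le_div_iff₀ hβ).1 ht
  exact (analyticAt_CCovIter_slice L hL hG k U₀ hU₀ hα hα3 hα4 h52 hsmall hc₃ hβ hB hj z κ ht').differentiableAt
    |>.differentiableWithinAt

include hL hG hU₀ hα hα3 hα4 h52 hb hsmall hc₃ hβ hB in
/-- **CAUCHY'S ESTIMATE FOR THE THIRD SLICE DERIVATIVE**: `‖(d³/dt³)C_j(U₀, tB)(c)|_{t=0}‖ ≤ 3!·C₂(Lʲ)²b⁻¹β³` (Mathlib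
`Complex.norm_iteratedDeriv_le_of_forall_mem_sphere_norm_le` on the circle `|t| = b/β`, where (135) gives `‖C_j(U₀, tB)(c)‖ ≤ C₂(Lʲ)²b²`).
[cite: Balaban1985Averaging, (135)–(136) pp.38–39] -/
theorem norm_iteratedDeriv_three_CCovIter_slice_le {j : ℕ} (hj : j ≤ k) (z : Site d) (κ : Fin d) :
    ‖iteratedDeriv 3 (fun t : ℂ => CCovIter L U₀ (t • B) j z κ) 0‖ ≤ (Nat.factorial 3 : ℕ) * (C₂ * ((L : ℝ) ^ j) ^ 2 * b⁻¹ * β ^ 3) := by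
  have hR : 0 < b / β := div_pos hb hβ
  have hsph : ∀ t ∈ sphere (0 : ℂ) (b / β), ‖CCovIter L U₀ (t • B) j z κ‖ ≤ C₂ * ((L : ℝ) ^ j) ^ 2 * b ^ 2 := by
    intro t ht
    have htn : ‖t‖ = b / β := by simpa using ht
    have ht' : ‖t‖ * β ≤ b := by rw [htn, div_mul_cancel₀ b hβ.ne']
    have h := norm_CCovIter_slice_le_closed L hL hG k U₀ hU₀ hα hα3 hα4 h52 hsmall hc₃ hβ hB hj z κ ht'
    refine h.trans (le_of_eq ?_)
    rw [htn]
    field_simp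
  have h := Complex.norm_iteratedDeriv_le_of_forall_mem_sphere_norm_le 3 hR
    (diffContOnCl_CCovIter_slice L hL hG k U₀ hU₀ hα hα3 hα4 h52 hb hsmall hc₃ hβ hB hj z κ) hsph
  refine h.trans (le_of_eq ?_)
  have hb0 : b ≠ 0 := hb.ne'
  have hβ0 : β ≠ 0 := hβ.ne'
  field_simp

include hL hG hU₀ hα hα3 hα4 h52 hb hsmall hc₃ hβ hB in
/-- **SIZE OF THE THIRD-ORDER TERM**: `‖C_j⁽³⁾(U₀, B)(c)‖ ≤ C₂·(Lʲ)²·b⁻¹·β³` for a field with `‖B_b‖ ≤ β` — cubic in the field, the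
`c₃`-type constant of [B11] (56) made explicit (Cauchy's estimate at the witness radius `b` of the regime).
[cite: Balaban1985Averaging, (135)–(136) pp.38–39] [cite: Balaban1985Variational, (56) p.286] -/
theorem norm_CCovIter3_le {j : ℕ} (hj : j ≤ k) (z : Site d) (κ : Fin d) :
    ‖CCovIter3 L U₀ B j z κ‖ ≤ C₂ * ((L : ℝ) ^ j) ^ 2 * b⁻¹ * β ^ 3 := by
  have h := norm_iteratedDeriv_three_CCovIter_slice_le L hL hG k U₀ hU₀ hα hα3 hα4 h52 hb hsmall hc₃ hβ hB hj z κ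
  have h6 : (0 : ℝ) < ((Nat.factorial 3 : ℕ) : ℝ) := by positivity
  rw [CCovIter3_def, norm_smul, norm_inv, Complex.norm_natCast]
  rw [inv_mul_le_iff₀ h6]
  exact h

include hL hG hU₀ hα hα3 hα4 h52 hb hsmall hc₃ hβ hB in
/-- the slice is analytic at `0` (from `B7Eq136Expansion.analyticAt_CCovIter_slice`). [cite: Balaban1985Averaging, Prop. 4 p.38] -/
private theorem analyticAt_slice_zero {j : ℕ} (hj : j ≤ k) (z : Site d) (κ : Fin d) :
    AnalyticAt ℂ (fun t : ℂ => CCovIter L U₀ (t • B) j z κ) 0 :=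
  analyticAt_CCovIter_slice L hL hG k U₀ hU₀ hα hα3 hα4 h52 hsmall hc₃ hβ hB hj z κ (by simpa using hb.le)

include hL hG hU₀ hα hα3 hα4 h52 hb hsmall hc₃ hβ hB in
/-- **`C_j⁽³⁾` IS THE NEXT DIVIDED-SLOPE COEFFICIENT**: `C_j⁽³⁾(U₀, B)(c) = leadCoeff (t ↦ C_j(U₀, tB)(c) − t²·C_j⁽²⁾(U₀, B)(c)) 3` — after
removing the second-order term (r08's `leadCoeff … 2` = `CCovIter2`, `B7Eq136Expansion.CCovIter2_eq_leadCoeff`), the third-order term of (136) is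
r08's order-`3` coefficient of what remains (`B11SchwarzRemainder.leadCoeff`), so the readings there apply to THIS object.
[cite: Balaban1985Averaging, (136) p.39] [cite: Balaban1985Variational, (56) p.286] -/
theorem CCovIter3_eq_leadCoeff {j : ℕ} (hj : j ≤ k) (z : Site d) (κ : Fin d) :
    CCovIter3 L U₀ B j z κ =
      leadCoeff (fun t : ℂ => CCovIter L U₀ (t • B) j z κ - t ^ 2 • CCovIter2 L U₀ B j z κ) 3 := by
  have han := analyticAt_slice_zero L hL hG k U₀ hU₀ hα hα3 hα4 h52 hb hsmall hc₃ hβ hB hj z κ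
  have hψ : AnalyticAt ℂ (fun t : ℂ => CCovIter L U₀ (t • B) j z κ - t ^ 2 • CCovIter2 L U₀ B j z κ) 0 :=
    han.sub ((analyticAt_id.pow 2).smul analyticAt_const)
  rw [leadCoeff_eq_inv_factorial_smul_iteratedDeriv hψ 3, CCovIter3_def,
    iteratedDeriv_three_sub_sq_smul (han.contDiffAt.of_le le_top)]

include hL hG hU₀ hα hα3 hα4 h52 hb hsmall hc₃ hβ hB in
/-- the slice minus its second-order term is differentiable on the disc and CUBICALLY bounded there:
`‖C_j(U₀, tB)(c) − t²C_j⁽²⁾(U₀, B)(c)‖ ≤ 2C₂(Lʲ)²β³b⁻¹·|t|³` (`B7Eq136Expansion.norm_CCovIter_sub_CCovIter2_slice_le`).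
[cite: Balaban1985Averaging, (136) p.39] -/
private theorem sub_two_differentiableOn_and_bound {j : ℕ} (hj : j ≤ k) (z : Site d) (κ : Fin d) :
    DifferentiableOn ℂ (fun t : ℂ => CCovIter L U₀ (t • B) j z κ - t ^ 2 • CCovIter2 L U₀ B j z κ) (ball 0 (b / β)) ∧
      ∀ t ∈ ball (0 : ℂ) (b / β), ‖CCovIter L U₀ (t • B) j z κ - t ^ 2 • CCovIter2 L U₀ B j z κ‖ ≤
        2 * (C₂ * ((L : ℝ) ^ j) ^ 2 * β ^ 3 * b⁻¹) * ‖t‖ ^ 3 := by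
  refine ⟨?_, fun t ht => norm_CCovIter_sub_CCovIter2_slice_le L hL hG k U₀ hU₀ hα hα3 hα4 h52 hb hsmall hc₃ hβ hB hj z κ ht⟩
  exact (differentiableOn_CCovIter_slice L hL hG k U₀ hU₀ hα hα3 hα4 h52 hsmall hc₃ hβ hB hj z κ).sub
    ((differentiableOn_id.pow 2).smul_const _)

include hL hG hU₀ hα hα3 hα4 h52 hb hsmall hc₃ hβ hB in
/-- **«THE NEXT HOMOGENEOUS TERM»**: `t⁻³·(C_j(U₀, tB)(c) − t²·C_j⁽²⁾(U₀, B)(c)) → C_j⁽³⁾(U₀, B)(c)` as `t → 0`, `t ≠ 0` — (136) read on the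
slice: after `C^{(2)}` comes `C^{(3)}` («homogeneous polynomials of n-th order», [B11] (56)).
[cite: Balaban1985Averaging, (136) p.39] [cite: Balaban1985Variational, (56) p.286] -/
theorem tendsto_CCovIter3 {j : ℕ} (hj : j ≤ k) (z : Site d) (κ : Fin d) :
    Tendsto (fun t : ℂ => (t ^ 3)⁻¹ • (CCovIter L U₀ (t • B) j z κ - t ^ 2 • CCovIter2 L U₀ B j z κ)) (𝓝[≠] (0 : ℂ))
      (𝓝 (CCovIter3 L U₀ B j z κ)) := by
  have hr : 0 < b / β := div_pos hb hβ
  obtain ⟨hd, hKb⟩ := sub_two_differentiableOn_and_bound L hL hG k U₀ hU₀ hα hα3 hα4 h52 hb hsmall hc₃ hβ hB hj z κ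
  have hM : ∀ t ∈ ball (0 : ℂ) (b / β), ‖CCovIter L U₀ (t • B) j z κ - t ^ 2 • CCovIter2 L U₀ B j z κ‖ ≤
      2 * (C₂ * ((L : ℝ) ^ j) ^ 2 * β ^ 3 * b⁻¹) * (b / β) ^ 3 := by
    intro t ht
    have ht' : ‖t‖ < b / β := mem_ball_zero_iff.mp ht
    have hK : 0 ≤ 2 * (C₂ * ((L : ℝ) ^ j) ^ 2 * β ^ 3 * b⁻¹) := by
      have := hb.le
      positivity
    exact (hKb t ht).trans (mul_le_mul_of_nonneg_left (pow_le_pow_left₀ (norm_nonneg t) ht'.le 3) hK)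
  rw [CCovIter3_eq_leadCoeff L hL hG k U₀ hU₀ hα hα3 hα4 h52 hb hsmall hc₃ hβ hB hj z κ]
  exact tendsto_leadCoeff hr hd hM (OrderGe.of_bound_on_ball hr hKb)

include hL hG hU₀ hα hα3 hα4 h52 hb hsmall hc₃ hβ hB in
/-- **THE REMAINDER AFTER THE THIRD-ORDER TERM IS QUARTIC, along the slice**: for `|t| < b/β`,
`‖C_j(U₀, tB)(c) − t²·C_j⁽²⁾(U₀, B)(c) − t³·C_j⁽³⁾(U₀, B)(c)‖ ≤ 3C₂(Lʲ)²β⁴b⁻²·|t|⁴` («C_k^{(4)}(U₀, A) + …»: r08's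
`norm_sub_leadCoeff_le_of_pow_bound` at order `3` on the slice minus its second-order term, cubic bound `2C₂(Lʲ)²β³/b`, coefficient bound
`C₂(Lʲ)²β³/b`, radius `b/β`). [cite: Balaban1985Averaging, (136) p.39] [cite: Balaban1985Variational, (56) p.286] -/
theorem norm_CCovIter_sub_two_three_slice_le {j : ℕ} (hj : j ≤ k) (z : Site d) (κ : Fin d) {t : ℂ}
    (ht : t ∈ ball (0 : ℂ) (b / β)) :
    ‖CCovIter L U₀ (t • B) j z κ - t ^ 2 • CCovIter2 L U₀ B j z κ - t ^ 3 • CCovIter3 L U₀ B j z κ‖ ≤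
      3 * (C₂ * ((L : ℝ) ^ j) ^ 2 * β ^ 4 * (b ^ 2)⁻¹) * ‖t‖ ^ 4 := by
  have hr : 0 < b / β := div_pos hb hβ
  obtain ⟨hd, hKb⟩ := sub_two_differentiableOn_and_bound L hL hG k U₀ hU₀ hα hα3 hα4 h52 hb hsmall hc₃ hβ hB hj z κ
  have hK : 0 ≤ 2 * (C₂ * ((L : ℝ) ^ j) ^ 2 * β ^ 3 * b⁻¹) := by
    have := hb.le
    positivity
  have hA : ‖leadCoeff (fun t : ℂ => CCovIter L U₀ (t • B) j z κ - t ^ 2 • CCovIter2 L U₀ B j z κ) 3‖ ≤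
      C₂ * ((L : ℝ) ^ j) ^ 2 * b⁻¹ * β ^ 3 := by
    rw [← CCovIter3_eq_leadCoeff L hL hG k U₀ hU₀ hα hα3 hα4 h52 hb hsmall hc₃ hβ hB hj z κ]
    exact norm_CCovIter3_le L hL hG k U₀ hU₀ hα hα3 hα4 h52 hb hsmall hc₃ hβ hB hj z κ
  have h := norm_sub_leadCoeff_le_of_pow_bound hr hK hd hKb hA ht
  rw [← CCovIter3_eq_leadCoeff L hL hG k U₀ hU₀ hα hα3 hα4 h52 hb hsmall hc₃ hβ hB hj z κ] at h
  refine h.trans (le_of_eq ?_)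
  have hb0 : b ≠ 0 := hb.ne'
  have hβ0 : β ≠ 0 := hβ.ne'
  rw [inv_div]
  field_simp
  ring

include hL hG hU₀ hα hα3 hα4 h52 hb hsmall hc₃ hβ hB in
/-- **(136) BEYOND THIRD ORDER IS QUARTIC**: for a field `B` with `‖B_b‖ ≤ β < b`,
`‖C_j(U₀, B)(c) − C_j⁽²⁾(U₀, B)(c) − C_j⁽³⁾(U₀, B)(c)‖ ≤ 3C₂(Lʲ)²b⁻²·β⁴` — the Taylor-remainder hypothesis `h4` of
`B11Eq56Expansion.eq56_order3` with `K₄ = 3C₂(Lʲ)²/b²`, concretely. [cite: Balaban1985Averaging, (136) p.39] [cite: Balaban1985Variational, (56) p.286] -/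
theorem norm_CCovIter_sub_two_three_le {j : ℕ} (hj : j ≤ k) (z : Site d) (κ : Fin d) (hβb : β < b) :
    ‖CCovIter L U₀ B j z κ - CCovIter2 L U₀ B j z κ - CCovIter3 L U₀ B j z κ‖ ≤
      3 * (C₂ * ((L : ℝ) ^ j) ^ 2 * (b ^ 2)⁻¹) * β ^ 4 := by
  have h1 : (1 : ℂ) ∈ ball (0 : ℂ) (b / β) := by
    rw [mem_ball_zero_iff, norm_one]
    exact (one_lt_div hβ).2 hβb
  have h := norm_CCovIter_sub_two_three_slice_le L hL hG k U₀ hU₀ hα hα3 hα4 h52 hb hsmall hc₃ hβ hB hj z κ h1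
  rw [one_smul, one_pow, one_pow, one_smul, one_smul, norm_one] at h
  refine h.trans (le_of_eq ?_)
  ring

end Regime

end Literature.MathematicalPhysics.QuantumFieldTheory.Balaban1983to89.B7Eq136ThirdOrder

end
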